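import Summits.BirchSwinnertonDyer.Rank1Residual.Partition.CornersDischarged
import Literature.NumberTheory.EllipticCurves.Greenberg1999.RankZeroEulerCharacteristicOddPrimeProofs
import Summits.BirchSwinnertonDyer.Rank1Residual.X1.PadicSigmaThreeExistence
import HarnessLib

/-!
# The joint §A/§C closing forms with the Mazur–Tate `σ`-existence fact DISCHARGED
# (cell `b2b-bsdres`, seat rmap-1 gen 12; RESIDUAL-MAP.md §A / §C, §I; kernel 12 of the seat)

HONEST FRAMING (run/shared/lean/b2b/bsd-rank1-residual/, verbatim in every file): the goal of the
cell is to DELETE the COMBINATION-SHAPED residual classes of the Birch–Swinnerton-Dyer formula for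
ALL analytic-rank `≤ 1` elliptic curves over `ℚ` — "full BSD formula for every rank `≤ 1` curve in
class `C`" assembled STRICTLY from published theorems — so that the rank-`≤ 1` remainder becomes
exactly the CONSTRUCTION-SHAPED classes, which are TYPED (missing-input `Prop`s), NOT attempted.
This is not "finishing BSD". Research routes; no claim beyond the stated classes; nothing booked;
no label changes. THEOREMS ONLY (no definition, no named fact, no `sorry`); every published theorem
enters as one of the tree's existing named Literature facts BY NAME.

Bookkeeping only. Kernel 11
(`Partition/CornersDischarged.lean`, p312779) states the joint good-ordinary-or-multiplicative form of
`BSD(E,p)` at `p ≥ 5`, `r_an ≤ 1`, non-CM, modulo TWENTY-SEVEN named published facts + the two X2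
closure terms + per-pair certificate binders. Two of the twenty-seven — `Schneider1985_order_charGenerator`
(A23: BMS 2016 Thm 1.7 for `p ≥ 5`) and `greenberg_charValue_rankZero` (Greenberg 1999 Thm 4.1) — are
DERIVED in the tree from the odd-prime Schneider fact `Schneider1985_order_charGenerator_odd` (A35) and
the Mazur–Tate `σ` existence fact `mazur_tate_sigma_exists_odd` (A34):
`Schneider1985_order_charGenerator.of_odd`, `greenberg_charValue_rankZero_of_Schneider1985_odd`
(`Literature/…/Greenberg1999/RankZeroEulerCharacteristicOddPrimeProofs.lean`). With A34 now a THEOREM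
(`X1.PadicSigmaThree.mazur_tate_sigma_exists_odd_holds`, x1a gen 20: the `σ`-pair at `p = 3` by the
explicit chart of the ordinary family, Blakestad–Grant's criteria and the gen-19 reduction), the joint
form restates on TWENTY-SIX named facts: {A23, Greenberg 4.1} ↦ {A35}. The headline / corner / `p = 3`
forms of kernel 11 (TWELVE named facts) are NOT re-threaded: there the same feed only swaps `hGr` for
`hSo` (twelve stays twelve). No class label, mark or number of the RESIDUAL-MAP moves; the statements
are kernel 11's with two binders fed.

References: RESIDUAL-MAP.md §A / §C / §I (SIGNED-FINAL 2026-08-21T15:00Z) and the seat's POST-FINAL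
notes (gen 12 NOTE 15); `Partition/CornersDischarged.lean` (p312779); CITED-FACTS.md A23 / A34 / A35;
[BalakrishnanMullerStein2015] Thm. 1.7; [GreenbergLNM1716] Thm. 4.1; [MazurSteinTate2006] Thm. 1.3;
[BlakestadGrant2023].
-/

noncomputable section

open scoped Classical MatrixGroups ModularForm NumberField

namespace Summit.BirchSwinnertonDyer.Rank1Residual

open CongruenceSubgroup WeierstrassCurve PowerSeries Literature.NumberTheory.EllipticCurves
  Literature.NumberTheory.EllipticCurves.Rank1Residual
  Literature.NumberTheory.EllipticCurves.ModularForms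
  Literature.NumberTheory.EllipticCurves.Wuthrich2014
  Literature.NumberTheory.EllipticCurves.GreenbergVatsal2000
  Literature.NumberTheory.EllipticCurves.Rank1Residual.Typed
  Literature.NumberTheory.EllipticCurves.Skinner2016
  Literature.NumberTheory.EllipticCurves.SteinWuthrich2013
  Literature.NumberTheory.EllipticCurves.Disegni2020
  Literature.NumberTheory.EllipticCurves.EmertonPollackWeston2006
  X2.ClassClosureEntireFree

section Curve

variable {W : WeierstrassCurve ℚ} [W.IsElliptic] [W.IsGloballyMinimal] {p : ℕ} [Fact p.Prime]

/-- **The joint §A/§C form at `p ≥ 5` on TWENTY-SIX named facts** (kernel 11's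
`bsdp_goodOrd_or_mult_of_five_le_rankLeOne_certificates_targetA_discharged`, p312779, displayed
TWENTY-SEVEN): the pair `hS : Schneider1985_order_charGenerator` (BMS 2016 Thm 1.7, `p ≥ 5`) and
`hGr : greenberg_charValue_rankZero` (Greenberg 1999 Thm 4.1) is FED from the single odd-prime fact
`hSo : Schneider1985_order_charGenerator_odd` (BMS 2016 Thm 1.7 at its printed generality `p > 2`) via
the tree theorems `Schneider1985_order_charGenerator.of_odd` and
`greenberg_charValue_rankZero_of_Schneider1985_odd hSo mazur_tate_sigma_exists_odd_holds` — the
Mazur–Tate `σ` existence fact A34 being a THEOREM of the tree (x1a gen 20). Every other binder, every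
case split and the conclusion are kernel 11's verbatim. [folklore] -/
theorem bsdp_goodOrd_or_mult_of_five_le_rankLeOne_certificates_targetA_sigmaDischarged
    (hSo : Schneider1985_order_charGenerator_odd)
    (hBCS : BurungaleCastellaSkinner2025.cor131_padicValRat_bsd_rank_le_one)
    (hBCSa : burungale_castella_skinner_charIdeal_eq_padicLFunction)
    (hGZK : rank_eq_analyticRank_of_analyticRank_le_one)
    (hCGS : CastellaGrossiSkinner2025.thmD_padicValRat_bsd_rank_le_one)
    (hGVg : GreenbergVatsal2000.thm13_charIdeal_eq_of_gvPar)
    (hmodP : nonempty_modularParametrizationData)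
    (hPR : perrinRiou_rankOne_leadingTerms)
    (hΩ : realPeriodRat_eq_unit_mul_plusPeriod)
    (hSk : Skinner2016.thmC_padicValRat_bsd_rank_zero) (hA : thmA_charIdeal_multiplicative)
    (hD : thm1_padicBSD_rankOne_multiplicative)
    (hWu : thm16_charIdeal_dvd_multiplicative_of_reducible)
    (hJs : thm61_splitMultiplicative) (hJn : thm61_nonsplitMultiplicative)
    (hHs : exists_isSplitMultCanonical) (hHn : exists_isMultCanonical)
    (hGS : ∀ (W : WeierstrassCurve ℚ) [W.IsElliptic] [W.IsGloballyMinimal] (p : ℕ) [Fact p.Prime],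
      greenberg_stevens (W := W) (p := p))
    (hHida : hida_exists_congruent_ordinary_newform_of_multiplicative)
    (h311e : thm311_cotorsion_weightK_member) (hT1a : thm1_muAlg_of_weightK_member)
    (hT2 : Wan2015.thm4_rational_weightK_member_of_bdd)
    (hT1b : thm513_transfer_from_weightK_member_of_bdd)
    (h61 : DeligneSerre1974.thm61_exists_adicGaloisRep) (h326 : Hida2000_thm326_ordinary)
    (hKato : kato_charIdeal_dvd_multiplicative_of_surjective)
    (hGV : lambdaMu_multiplicative_of_gvPar) (hTA : X2.TargetA)
    (hcm : ¬ W.HasCM) (hr : W.analyticRank ≤ 1) (h5 : 5 ≤ p) (hdom : GoodOrd W p ∨ Mult W p)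
    (hcert1 : ClassX1 W p → GVPar W p →
      ∃ (N : ℕ) (_ : NeZero N) (f : CuspForm (Gamma0 N) 2), IsNewformOf W f ∧
        ∃ n : ℕ, (p : ℝ) ^ (-n : ℤ) < ‖padicLRiemannSum f (unitRoot W p : ℚ_[p]) 1 n‖)
    (hμ9 : ClassX9 W p → ∀ (κ : ZpExtension ℚ p) (γ : Field.absoluteGaloisGroup ℚ),
        κ.IsCyclotomic → κ.IsTopGenerator γ → IsCyclotomicVariable p γ →
      ∀ (D : W.SelmerDualData κ γ), D.mu = 0)
    (hcert9 : ClassX9 W p → ∀ [NeZero (W.conductorNorm ℤ)]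
        (f : CuspForm (CongruenceSubgroup.Gamma0 (W.conductorNorm ℤ)) 2),
        IsNewformOf W f → ∀ (ϖ : ℚ), (ϖ : ℝ) * W.realPeriodRat = plusPeriod f →
      ∃ n : ℕ, ‖PowerSeries.coeff n
        (PowerSeries.C (ϖ : ℚ_[p]) * padicLFunction f (unitRoot W p : ℚ_[p]))‖ = 1)
    (hSch9 : ClassX9 W p → ∀ Dh : PAdicHeightData W p, Dh.IsCanonical → SchneiderConjecture Dh)
    (hSchN : ∀ (q : ℚ_[p]) (Dh : PAdicHeightData W p), q ≠ 0 → ‖q‖ < 1 → tateJ q = (W.j : ℚ_[p]) →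
      IsMultCanonical Dh q → SchneiderConjecture Dh)
    (hSchS : ∀ (Dq : TateParameterData W p) (Dh : PAdicHeightData W p),
      IsSplitMultCanonical Dh Dq → SchneiderConjecture Dh)
    (hμ11 : ClassX11a W p ∨ (ClassX11b W p ∧ ¬ Ram W p) → Surj W p → X11a.MuAnZeroAt W p)
    (hA1 : ¬ (ClassX1 W p ∧ ¬ GVPar W p)) (hX11a : ¬ (ClassX11a W p ∧ ¬ Surj W p))
    (hX2 : ¬ (ClassX2 W p ∧ ¬ (W.analyticRank = 0 ∧ GVPar W p) ∧
      ¬ (W.analyticRank = 1 ∧ ¬ W.HasSplitMultiplicativeReductionAtPrime p ∧ GVPar W p)))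
    (hX11b : ¬ (ClassX11b W p ∧ ¬ Ram W p ∧ (¬ Surj W p ∨
      (W.HasSplitMultiplicativeReductionAtPrime p ∧
        ¬ ∃ (m : ℕ) (_ : Fact m.Prime), m ≠ p ∧ W.HasMultiplicativeReductionAtPrime m)))) :
    BSDp W p :=
  bsdp_goodOrd_or_mult_of_five_le_rankLeOne_certificates_targetA_discharged
    hBCS hBCSa hGZK hCGS hGVg (greenberg_charValue_rankZero_of_Schneider1985_odd hSo
      X1.PadicSigmaThree.mazur_tate_sigma_exists_odd_holds) hmodP
    (Schneider1985_order_charGenerator.of_odd hSo) hPR hΩ hSk hA hD hWu hJs hJn hHs hHn hGS hHida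
    h311e hT1a hT2 hT1b h61 h326 hKato hGV hTA hcm hr h5 hdom hcert1 hμ9 hcert9 hSch9 hSchN hSchS
    hμ11 hA1 hX11a hX2 hX11b

/-- **Partition form of the above on TWENTY-SIX named facts** (kernel 11's
`bsdp_or_corner_goodOrd_or_mult_of_five_le_certificates_targetA_discharged` with the same feed). [folklore] -/
theorem bsdp_or_corner_goodOrd_or_mult_of_five_le_certificates_targetA_sigmaDischarged
    (hSo : Schneider1985_order_charGenerator_odd)
    (hBCS : BurungaleCastellaSkinner2025.cor131_padicValRat_bsd_rank_le_one)
    (hBCSa : burungale_castella_skinner_charIdeal_eq_padicLFunction)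
    (hGZK : rank_eq_analyticRank_of_analyticRank_le_one)
    (hCGS : CastellaGrossiSkinner2025.thmD_padicValRat_bsd_rank_le_one)
    (hGVg : GreenbergVatsal2000.thm13_charIdeal_eq_of_gvPar)
    (hmodP : nonempty_modularParametrizationData)
    (hPR : perrinRiou_rankOne_leadingTerms)
    (hΩ : realPeriodRat_eq_unit_mul_plusPeriod)
    (hSk : Skinner2016.thmC_padicValRat_bsd_rank_zero) (hA : thmA_charIdeal_multiplicative)
    (hD : thm1_padicBSD_rankOne_multiplicative)
    (hWu : thm16_charIdeal_dvd_multiplicative_of_reducible)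
    (hJs : thm61_splitMultiplicative) (hJn : thm61_nonsplitMultiplicative)
    (hHs : exists_isSplitMultCanonical) (hHn : exists_isMultCanonical)
    (hGS : ∀ (W : WeierstrassCurve ℚ) [W.IsElliptic] [W.IsGloballyMinimal] (p : ℕ) [Fact p.Prime],
      greenberg_stevens (W := W) (p := p))
    (hHida : hida_exists_congruent_ordinary_newform_of_multiplicative)
    (h311e : thm311_cotorsion_weightK_member) (hT1a : thm1_muAlg_of_weightK_member)
    (hT2 : Wan2015.thm4_rational_weightK_member_of_bdd)
    (hT1b : thm513_transfer_from_weightK_member_of_bdd)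
    (h61 : DeligneSerre1974.thm61_exists_adicGaloisRep) (h326 : Hida2000_thm326_ordinary)
    (hKato : kato_charIdeal_dvd_multiplicative_of_surjective)
    (hGV : lambdaMu_multiplicative_of_gvPar) (hTA : X2.TargetA)
    (hcm : ¬ W.HasCM) (hr : W.analyticRank ≤ 1) (h5 : 5 ≤ p) (hdom : GoodOrd W p ∨ Mult W p)
    (hcert1 : ClassX1 W p → GVPar W p →
      ∃ (N : ℕ) (_ : NeZero N) (f : CuspForm (Gamma0 N) 2), IsNewformOf W f ∧
        ∃ n : ℕ, (p : ℝ) ^ (-n : ℤ) < ‖padicLRiemannSum f (unitRoot W p : ℚ_[p]) 1 n‖)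
    (hμ9 : ClassX9 W p → ∀ (κ : ZpExtension ℚ p) (γ : Field.absoluteGaloisGroup ℚ),
        κ.IsCyclotomic → κ.IsTopGenerator γ → IsCyclotomicVariable p γ →
      ∀ (D : W.SelmerDualData κ γ), D.mu = 0)
    (hcert9 : ClassX9 W p → ∀ [NeZero (W.conductorNorm ℤ)]
        (f : CuspForm (CongruenceSubgroup.Gamma0 (W.conductorNorm ℤ)) 2),
        IsNewformOf W f → ∀ (ϖ : ℚ), (ϖ : ℝ) * W.realPeriodRat = plusPeriod f →
      ∃ n : ℕ, ‖PowerSeries.coeff n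
        (PowerSeries.C (ϖ : ℚ_[p]) * padicLFunction f (unitRoot W p : ℚ_[p]))‖ = 1)
    (hSch9 : ClassX9 W p → ∀ Dh : PAdicHeightData W p, Dh.IsCanonical → SchneiderConjecture Dh)
    (hSchN : ∀ (q : ℚ_[p]) (Dh : PAdicHeightData W p), q ≠ 0 → ‖q‖ < 1 → tateJ q = (W.j : ℚ_[p]) →
      IsMultCanonical Dh q → SchneiderConjecture Dh)
    (hSchS : ∀ (Dq : TateParameterData W p) (Dh : PAdicHeightData W p),
      IsSplitMultCanonical Dh Dq → SchneiderConjecture Dh)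
    (hμ11 : ClassX11a W p ∨ (ClassX11b W p ∧ ¬ Ram W p) → Surj W p → X11a.MuAnZeroAt W p) :
    BSDp W p ∨ (ClassX1 W p ∧ ¬ GVPar W p) ∨ (ClassX11a W p ∧ ¬ Surj W p) ∨
      (ClassX2 W p ∧ ¬ (W.analyticRank = 0 ∧ GVPar W p) ∧
        ¬ (W.analyticRank = 1 ∧ ¬ W.HasSplitMultiplicativeReductionAtPrime p ∧ GVPar W p)) ∨
      (ClassX11b W p ∧ ¬ Ram W p ∧ (¬ Surj W p ∨
        (W.HasSplitMultiplicativeReductionAtPrime p ∧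
          ¬ ∃ (m : ℕ) (_ : Fact m.Prime), m ≠ p ∧ W.HasMultiplicativeReductionAtPrime m))) :=
  bsdp_or_corner_goodOrd_or_mult_of_five_le_certificates_targetA_discharged
    hBCS hBCSa hGZK hCGS hGVg (greenberg_charValue_rankZero_of_Schneider1985_odd hSo
      X1.PadicSigmaThree.mazur_tate_sigma_exists_odd_holds) hmodP
    (Schneider1985_order_charGenerator.of_odd hSo) hPR hΩ hSk hA hD hWu hJs hJn hHs hHn hGS hHida
    h311e hT1a hT2 hT1b h61 h326 hKato hGV hTA hcm hr h5 hdom hcert1 hμ9 hcert9 hSch9 hSchN hSchS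
    hμ11

end Curve

end Summit.BirchSwinnertonDyer.Rank1Residual

end
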